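import Literature.MathematicalPhysics.QuantumFieldTheory.Balaban1983to89.B2Eq228Conditioning
import Literature.MathematicalPhysics.QuantumFieldTheory.Balaban1983to89.B14Eq126CondGaussian
import Literature.MathematicalPhysics.QuantumFieldTheory.Balaban1983to89.B14Eq325Split
import Literature.MathematicalPhysics.QuantumFieldTheory.Balaban1983to89.Step

/-!
# `Balaban1983to89.B14Eq325CondIntegral` — [Balaban1988Convergent] (3.23)–(3.25) p. 270: the one-step operation
# `𝐓^{(k+1)}` = the CONDITIONAL INTEGRATION with respect to the fluctuation field `A_k` restricted to `Λ_{k+1}`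
# (exponential `exp[−½⟨A_k,C*Δ^{(k)}CA_k⟩ + ½⟨A_k,C*Δ^{(k)}CC^{(k)}(Λ_{k+1})C*Δ^{(k)}CA_k⟩]` of (3.23)), the product
# `𝐓_{k+1} = 𝐓^{(k+1)}𝐓_k` (3.24), and the last fluctuation integral of the representation (3.25)
# (`exp[−½⟨A,C*Δ^{(k)}CA⟩ − ⟨A,C*Δ^{(k)}CA_k⟩ − ½⟨A_k,C*Δ^{(k)}CC^{(k)}(Λ_{k+1})C*Δ^{(k)}CA_k⟩ + …]`) — PROVED on the
# finite-dimensional block model (kind «model-instance»)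

statement-level skeleton of published theorems with citation tags; proofs where landed; nothing here is a
claim about the Yang–Mills mass gap

PDF held: `paper:balaban1988-cmp119-convergent-renormalization` (doi 10.1007/bf01217741; journal page = PDF page + 242);
(3.15) p. 268, (3.20)–(3.22) p. 269 and (3.23)–(3.25) p. 270 READ AS IMAGES on the ×4 renders
`run/shared/lean/pub/pub-balaban/b2b-balaban-ref1/pages/1988-cmp119-convergent-renormalization/…-p026-x4.png`, `…-p027-x4.png`,
`…-p028-x4.png`; (1.26), (1.28)–(1.29) pp. 253–254 (`…-p011-x4.png`, `…-p012-x4.png`) and (2.20)–(2.21) p. 258 (`…-p016-x4.png`).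

CITATION HEADER (lean-in-tree rule).  Source: T. Bałaban, *Convergent renormalization expansions for lattice gauge
theories*, Commun. Math. Phys. **119**, 243–285 (1988) [Balaban1988Convergent] (cell paper B14 = "[III]").
Mega-formalization `lit-balaban` (HOME `run/shared/lean/pub/lit-balaban/`), Phase-2 proof seat **p28** (generation 3,
`literature-prover-lit-balaban-p28-g3-0`), SKELETON row **B14.Eq3.23-3.25** (status before this file: «typed-existing
(abstract one-step op `Step.TkOps.ofOneStep`) · displays absent (cited downstream B15 p.188 "(3.25) [III]")»; fold owner
r11, referee ref-5).  WHAT IS REPRODUCED = the three displays (3.23)/(3.24)/(3.25) p. 270, as follows.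
RELATION TO THE OWNER'S FILE `B14.Eq325Split` (r11 g3, p247105, filed while this file was being written): that file
proves the exponent algebra of (3.23)/(3.25) over the (1.26) block data `(M, K, N)` taken as primitive (`blockQF`,
`outer323`, `inner325`, the free inner integral `= Z^{(0)}`, (3.24) as composition of maps) and is the row's file of
record; THIS file is its declared COMPLEMENT on the conditioning carrier of [Balaban1982Higgs2] (2.28): ONE positive
operator `C*Δ^{(k)}C` on the fluctuation fields over `Ω_{k+1}` with `Λ_{k+1} ⊂ Ω_{k+1}` a sub-region (blocks derived, not
postulated), the INTEGRAL identity (3.15) = `𝐓^{(k+1)}`[(3.25)-integral] by Fubini for every absolutely convergent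
integrand (§4), the conditional-law reading of the (3.25) Gaussian factor (§3), the Schur complement (§5), the knitting
with (1.26) `= exp[log Z^{(k)}(Λ_{k+1}) + 𝐄^{(k+1)}]` (§6) and (3.24) for `Step.TkOps.ofOneStep` (§7).  Nothing of
`B14.Eq325Split` is restated (different carriers; no declaration of that file is used or shadowed).

THE PRINTED TEXT (p. 270 [PDF 28], verbatim).  *"… in (3.15) as a sum of terms. We write this sum as a sum over domains
Λ_{k+1}, and for a fixed domain Λ_{k+1}, as a sum over the admissible sets S_{k+1}.  For each term of the obtained sum we
consider the conditional integral with respect to A_k restricted to Λ_{k+1}. The remaining integration with respect to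
A_k restricted to Ω_{k+1}∩Λᶜ_{k+1} is included into the operation 𝐓^{(k+1)}. Thus we define
  𝐓^{(k+1)} = Σ_{S_{k+1}} ∫dV_k|_{Ωᶜ_{k+1}} δ(V̄_kV_{k+1}⁻¹) ζ(Ωᶜ_{k+1}) z^{(k)} ∫dA_k|_{Ω_{k+1}∩Λᶜ_{k+1}} χ(Ω_{k+1}∩Λᶜ_{k+1}, S_{k+1})
     · exp[ −½⟨A_k, C*Δ^{(k)}CA_k⟩ + ½⟨A_k, C*Δ^{(k)}CC^{(k)}(Λ_{k+1})C*Δ^{(k)}CA_k⟩ ].                             (3.23)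
Here z^{(k)} denotes the product of factors corresponding to bonds in Γ_{k+1}∩Λᶜ_{k+1}. Denoting the sum of constants in
the first exponential in (3.15) by E₀^{(k)}, and defining  𝐓_{k+1} = 𝐓^{(k+1)}𝐓_k ,                                   (3.24)
we get
  (Tρ_k)(V_{k+1}) = Σ_{{Ω_j},{Λ_j}} χ_{k+1}(Ω_{k+1}) 𝐓_{k+1} exp[A_k(g_k⁻², U_{k+1}) + E₀^{(k)}]
     · z^{(k)} ∫dA|_{Λ_{k+1}} χ^{(k)}(Λ_{k+1}) exp[ −½⟨A, C*Δ^{(k)}CA⟩ − ⟨A, C*Δ^{(k)}CA_k⟩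
       − ½⟨A_k, C*Δ^{(k)}CC^{(k)}(Λ_{k+1})C*Δ^{(k)}CA_k⟩ + 𝐏^{(k)}(g_k,(A_k,A)) + {…} + 𝐕^{(k)}(S_{k+1},(A_k,A)) ].      (3.25)
Here A_k denotes the fluctuation field on Ω_{k+1}∩Λᶜ_{k+1}, and A denotes this field on Λ_{k+1}."*

THE MODEL (finite-dimensional, the tree's conditioning carrier `B2Eq228Conditioning` of [Balaban1982Higgs2] (2.28) —
REUSED, nothing re-declared — and the block conventions of `B14.Eq126CondGaussian` = (1.26)).  The bonds of `Ω_{k+1}`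
carrying the fluctuation field `A_k` of (3.15) ↦ a finite type `S`; `Λ_{k+1} ⊂ Ω_{k+1}` ↦ a decidable predicate `p`
(`Λ`-bonds = `In p`, bonds of `Ω_{k+1}∩Λᶜ_{k+1}` = `Out p`); the fluctuation field on `Ω_{k+1}` ↦ `φ : S → ℝ` with Lebesgue
measure `dA_k = volume`; its two pieces: print's **`A`** (on `Λ_{k+1}`) ↦ `x = resIn p φ`, print's **`A_k`** (on
`Ω_{k+1}∩Λᶜ_{k+1}`) ↦ `y = resOut p φ`, and `φ = glue p x y`; the positive operator `C*Δ^{(k)}C` of the Gaussian in (3.15)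
↦ `A : Matrix S S ℝ` (positive definite; cf. (3.33)); its blocks `M = blkIn p A` (`ΛΛ`), `blkMix p A` (`Λ × Λᶜ`),
`K = blkMix' p A` (`Λᶜ × Λ`), `N = blkOut p A`; **`C^{(k)}(Λ_{k+1}) = M⁻¹`** = the covariance of the conditional Gaussian
measure `Z^{(k)}(Λ_{k+1})⁻¹ exp[−½⟨A,C*Δ^{(k)}CA⟩]dA` on `Λ_{k+1}` (as in (1.26), `B14.Eq126CondGaussian`), acting on
`Ω_{k+1}`-configurations through restriction to `Λ_{k+1}` and extension by zero (`CΛ`).  The four printed pairings are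
definitions with literal bodies (`pairOut` = `⟨A_k,C*Δ^{(k)}CA_k⟩`, `sandwich` = `⟨A_k,C*Δ^{(k)}CC^{(k)}(Λ_{k+1})C*Δ^{(k)}CA_k⟩`,
`pairIn` = `⟨A,C*Δ^{(k)}CA⟩`, `cross` = `⟨A,C*Δ^{(k)}CA_k⟩`), and so are the two printed exponentials: **`w323`** (the
exponential of (3.23)) and **`g325`** (the Gaussian factor of the last integral in (3.25)).  The characteristic functions,
`z^{(k)}`, `𝐏^{(k)} + {…} + 𝐕^{(k)}` are abstract functions/constants; the `V_k`-integration `∫dV_k δ(·)ζ(·)` of (3.23), the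
outer sum over `{Ω_j},{Λ_j}` and `exp[A_k + E₀^{(k)}]` of (3.25) are not objects of the Gaussian model (they are untouched
by the operation proved here).

WHAT IS PROVED (zero `sorry`, standard axioms).
 §1  the block formulas of the four printed pairings (`pairOut_eq`, `sandwich_eq` = `yᵀKM⁻¹Kᵀy` — the completed square of
     (1.26) —, `pairIn_eq`, `cross_eq`);
 §2  **the exponent bookkeeping (3.15) = (3.23) + (3.25)**: `exp[−½⟨A_k ⊕ A, C*Δ^{(k)}C(A_k ⊕ A)⟩] = w323(A_k)·g325(A, A_k)`
     (`weight_glue`) — the term `½⟨A_k,…C^{(k)}(Λ_{k+1})…A_k⟩` is added in (3.23) and subtracted in (3.25);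
 §3  **why it is a conditional integral**: the (3.25) Gaussian factor is the conditional law of `A` given `A_k` — mean
     `−C^{(k)}(Λ_{k+1})(C*Δ^{(k)}CA_k)↾_{Λ_{k+1}}` (= the tree's `condShift p A 0`, [Balaban1982Higgs2] (2.28) at source 0),
     covariance `C^{(k)}(Λ_{k+1})`: `g325_eq_gaussWeight`, `integral_g325_mul` (= `Z^{(k)}(Λ)·∫dμ_{C^{(k)}(Λ)}(A′)Ψ(A′ + shift)`,
     `integral_g325_mul_eq_inner`), normalization `integral_g325 = Z^{(k)}(Λ_{k+1})` for EVERY `A_k`;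
 §4  **THE IDENTITY (3.15) = 𝐓^{(k+1)}[(3.25)-integral]**: `∫dA_k|_{Ω_{k+1}} e^{−½⟨A_k,C*Δ^{(k)}CA_k⟩}F(A_k) = ∫dA_k|_{Ω∩Λᶜ}
     w323(A_k) ∫dA|_Λ g325(A,A_k) F(A_k ⊕ A)` for every `F` making the left side absolutely convergent
     (`integral_weight_mul_eq`, Fubini), discharged for bounded measurable `F` (`integral_weight_mul_eq_of_bounded`), and the
     literal sum-over-`S_{k+1}` form with `z^{(k)}`, `χ(Ω∩Λᶜ,S)`, `χ^{(k)}(Λ)` and the interaction (`opT323`, `inner325`, **`eq325`**);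
 §5  the (3.23) exponential is the MARGINAL weight of `A_k`: `∫dA|_Λ e^{−½⟨…⟩} = Z^{(k)}(Λ_{k+1})·w323(A_k)`
     (`integral_weight_glue`), `w323 = exp[−½⟨A_k, S A_k⟩]` with the Schur complement `S = N − KM⁻¹Kᵀ` (`w323_eq_schur`),
     `S` positive definite (`schur_posDef`), and the normalizations multiply: `Z(Ω_{k+1}) = Z^{(k)}(Λ_{k+1})·Z_S` (`gaussNorm_eq_mul`);
 §6  knitting with (1.26) (`B14.Eq126CondGaussian`, the same blocks one level down): the last integral of (3.25) with
     interaction `v − g⁻²V` equals `e^{−½ sandwich}·lhs126` and hence `exp[log Z^{(k)}(Λ_{k+1}) + 𝐄^{(k+1)}(Λ_{k+1},g,A_k)]` — the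
     subtracted `½⟨A_k,…⟩` cancels the completed square of (1.26) exactly (`inner_eq_exp_neg_half_sandwich_mul_lhs126`,
     **`inner_eq_exp_logZ_add_E`**), which is the point of the split ("the fundamental problem is to represent the logarithm
     of the last fluctuation field integral in the form described by the inductive assumption", p. 270);
 §7  **(3.24)** for the operations DEFINED by (2.20) (`Step.TkOps.ofOneStep`): `𝐓_{k+1}(X) = 𝐓^{(k+1)}(Z_{k+1}∩X)·𝐓_k(X)`
     with `𝐓_k(X)` the ordered product of the current one-step operations below scale `k` (`eq324`).
§8  (v1.1) THE BRIDGE to the owner's file of record `B14.Eq325Split` (r11 g3, p247105): with `M = blkIn`, `K = blkMix'`,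
     `N = blkOut` of the symmetric operator, `blockQF M K N (A, A_k) = ⟨A_k ⊕ A, C*Δ^{(k)}C(A_k ⊕ A)⟩` (`blockQF_eq_quadForm_glue`),
     `w323 = exp ∘ outer323` (`w323_eq_exp_outer323`), `g325 = exp ∘ inner325` (`g325_eq_exp_inner325`), so the identity of §4
     reads in that file's vocabulary: `∫dA_k e^{−½ blockQF} F = ∫ e^{outer323} ∫ e^{inner325} F` (`integral_exp_neg_half_blockQF_mul_eq`)
     — the two files of the row are one statement.
READING NOTE (informal, not a gap): (3.23)/(3.24) call `𝐓^{(k+1)}` the one-step operation integrating `V_k, A_k`, which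
(2.20)/(2.21) p. 258 index as `𝐓^{(k)}` ("This operation comes from the renormalization transformation T in the j+1-st
step"); `Step.TkOps` follows (2.20), so (3.24) reads `T (k+1) X = T1 (k+1) k (Z (k+1) ∩ X) * tail (k+1) k X`.
NOT HERE: the operators `C`, `Δ^{(k)}` themselves (B10/B12 rows), the `V_k`-integration and `δ`, `ζ`, the cluster
expansion of `𝐄^{(k+1)}` (B13), bounds.  No `sorry`.
-/

noncomputable section

open MeasureTheory Matrix Finset
open scoped BigOperators

namespace Literature.MathematicalPhysics.QuantumFieldTheory.Balaban1983to89.B14Eq325CondIntegral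

open B13GaugeDevices (gaussWeight gaussInt gaussNorm)
open B2Eq228Conditioning (In Out resIn resOut glue blkIn blkMix blkMix' blkOut weight condShift
  glue_apply_in glue_apply_out resIn_glue resOut_glue mulVec_glue_in mulVec_glue_out quadForm_glue)

variable {S : Type} [Fintype S] [DecidableEq S] (p : S → Prop) [DecidablePred p] (A : Matrix S S ℝ)

/-! ## §1. The dictionary: `A_k`, `A`, `C^{(k)}(Λ_{k+1})` and the four printed pairings -/

/-- Print's **`A_k`** in (3.23)/(3.25): *"A_k denotes the fluctuation field on Ω_{k+1}∩Λᶜ_{k+1}"* — a configuration `y` on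
`Λᶜ`-bonds, seen as a configuration on all of `Ω_{k+1}` vanishing on `Λ_{k+1}`. [cite: Balaban1988Convergent, (3.25) p.270] -/
def Ak (y : Out p → ℝ) : S → ℝ := glue p 0 y

/-- Print's **`A`** in (3.25): *"A denotes this field on Λ_{k+1}"* — a configuration `x` on `Λ`-bonds, seen on `Ω_{k+1}`
(zero off `Λ_{k+1}`). [cite: Balaban1988Convergent, (3.25) p.270] -/
def AΛ (x : In p → ℝ) : S → ℝ := glue p x 0

/-- **`C^{(k)}(Λ_{k+1})`** acting on `Ω_{k+1}`-configurations: restrict to `Λ_{k+1}`, apply the covariance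
`(C*Δ^{(k)}C)_{Λ_{k+1}}⁻¹ = M⁻¹` of the conditional Gaussian measure on `Λ_{k+1}` (the `C^{(0)}(Λ₁)` of (1.26) one level up),
extend by zero. [cite: Balaban1988Convergent, (3.23) p.270] -/
def CΛ (ψ : S → ℝ) : S → ℝ := glue p ((blkIn p A)⁻¹ *ᵥ resIn p ψ) 0

/-- `⟨A_k, C*Δ^{(k)}CA_k⟩` (first term of the exponential in (3.23)). [cite: Balaban1988Convergent, (3.23) p.270] -/
def pairOut (y : Out p → ℝ) : ℝ := Ak p y ⬝ᵥ A *ᵥ Ak p y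

/-- `⟨A_k, C*Δ^{(k)}C C^{(k)}(Λ_{k+1}) C*Δ^{(k)}C A_k⟩` (second term of (3.23), third term of (3.25)), literally: the operator
`C*Δ^{(k)}C ∘ C^{(k)}(Λ_{k+1}) ∘ C*Δ^{(k)}C` applied to `A_k`, paired with `A_k`. [cite: Balaban1988Convergent, (3.23) p.270] -/
def sandwich (y : Out p → ℝ) : ℝ := Ak p y ⬝ᵥ A *ᵥ CΛ p A (A *ᵥ Ak p y)

/-- `⟨A, C*Δ^{(k)}CA⟩` (first term of the last exponential in (3.25)). [cite: Balaban1988Convergent, (3.25) p.270] -/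
def pairIn (x : In p → ℝ) : ℝ := AΛ p x ⬝ᵥ A *ᵥ AΛ p x

/-- `⟨A, C*Δ^{(k)}CA_k⟩` (the cross term in (3.25)). [cite: Balaban1988Convergent, (3.25) p.270] -/
def cross (x : In p → ℝ) (y : Out p → ℝ) : ℝ := AΛ p x ⬝ᵥ A *ᵥ Ak p y

omit [Fintype S] [DecidableEq S] in
/-- `A_k ⊕ A`: the fluctuation field on `Ω_{k+1}` is the sum of its two pieces. [folklore] [cite: Balaban1988Convergent, (3.25) p.270] -/
theorem Ak_add_AΛ (x : In p → ℝ) (y : Out p → ℝ) : Ak p y + AΛ p x = glue p x y := by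
  funext s
  by_cases h : p s
  · have h1 := glue_apply_in p (0 : In p → ℝ) y ⟨s, h⟩
    have h2 := glue_apply_in p x (0 : Out p → ℝ) ⟨s, h⟩
    have h3 := glue_apply_in p x y ⟨s, h⟩
    simp only [Ak, AΛ, Pi.add_apply] at *
    rw [h1, h2, h3]; simp
  · have h1 := glue_apply_out p (0 : In p → ℝ) y ⟨s, h⟩
    have h2 := glue_apply_out p x (0 : Out p → ℝ) ⟨s, h⟩
    have h3 := glue_apply_out p x y ⟨s, h⟩
    simp only [Ak, AΛ, Pi.add_apply] at *
    rw [h1, h2, h3]; simp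

omit [DecidableEq S] in
/-- `⟨A_k, C*Δ^{(k)}CA_k⟩ = yᵀNy`, `N` the `Λᶜ × Λᶜ` block. [folklore] [cite: Balaban1988Convergent, (3.23) p.270] -/
theorem pairOut_eq (y : Out p → ℝ) : pairOut p A y = y ⬝ᵥ blkOut p A *ᵥ y := by
  unfold pairOut Ak
  rw [quadForm_glue]
  simp

omit [DecidableEq S] in
/-- `(C*Δ^{(k)}CA_k)↾_{Λ_{k+1}} = blkMix·y` (the `Λ × Λᶜ` block applied to `A_k`). [folklore] [cite: Balaban1988Convergent, (3.25) p.270] -/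
theorem resIn_mulVec_Ak (y : Out p → ℝ) : resIn p (A *ᵥ Ak p y) = blkMix p A *ᵥ y := by
  funext i
  show (A *ᵥ glue p 0 y) i = _
  rw [mulVec_glue_in]
  simp

/-- `⟨A_k, C*Δ^{(k)}C C^{(k)}(Λ_{k+1}) C*Δ^{(k)}C A_k⟩` in matrix form: `yᵀ (K M⁻¹ B) y` with `K = blkMix'` (`Λᶜ × Λ`), `B = blkMix`
(`Λ × Λᶜ`), `M⁻¹ = C^{(k)}(Λ_{k+1})` — no symmetry needed. [folklore] [cite: Balaban1988Convergent, (3.23) p.270] -/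
theorem sandwich_eq_matrix (y : Out p → ℝ) :
    sandwich p A y = y ⬝ᵥ (blkMix' p A * (blkIn p A)⁻¹ * blkMix p A) *ᵥ y := by
  unfold sandwich CΛ
  rw [resIn_mulVec_Ak]
  unfold Ak
  rw [dotProduct, B2Eq228Conditioning.sum_split p]
  simp only [glue_apply_in, glue_apply_out, Pi.zero_apply, zero_mul, sum_const_zero, zero_add,
    mulVec_glue_out, mulVec_zero, Pi.zero_apply, add_zero]
  rw [← mulVec_mulVec, ← mulVec_mulVec]
  rfl

/-- **The completed square**: for symmetric `C*Δ^{(k)}C`, `⟨A_k, C*Δ^{(k)}C C^{(k)}(Λ_{k+1}) C*Δ^{(k)}C A_k⟩ = (By)ᵀ M⁻¹ (By) =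
yᵀ K M⁻¹ Kᵀ y` (`B = blkMix = Kᵀ`) — the quantity `⟨Λ₁ᶜA, C*Δ₁CC^{(0)}(Λ₁)C*Δ₁CΛ₁ᶜA⟩` of (1.26) (`B14.Eq126CondGaussian.E1`)
one level up. [cite: Balaban1988Convergent, (3.23) p.270] -/
theorem sandwich_eq (hA : A.IsSymm) (y : Out p → ℝ) :
    sandwich p A y = (blkMix p A *ᵥ y) ⬝ᵥ (blkIn p A)⁻¹ *ᵥ (blkMix p A *ᵥ y) := by
  rw [sandwich_eq_matrix, ← mulVec_mulVec, ← mulVec_mulVec, B2Eq228Conditioning.blkMix'_eq_transpose p hA,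
    dotProduct_transpose_mulVec, dotProduct_comm]

omit [DecidableEq S] in
/-- `⟨A, C*Δ^{(k)}CA⟩ = xᵀMx`, `M` the `Λ × Λ` block. [folklore] [cite: Balaban1988Convergent, (3.25) p.270] -/
theorem pairIn_eq (x : In p → ℝ) : pairIn p A x = x ⬝ᵥ blkIn p A *ᵥ x := by
  unfold pairIn AΛ
  rw [quadForm_glue]
  simp

omit [DecidableEq S] in
/-- `⟨A, C*Δ^{(k)}CA_k⟩ = xᵀ(blkMix·y)`. [folklore] [cite: Balaban1988Convergent, (3.25) p.270] -/
theorem cross_eq (x : In p → ℝ) (y : Out p → ℝ) : cross p A x y = x ⬝ᵥ blkMix p A *ᵥ y := by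
  unfold cross AΛ Ak
  rw [dotProduct, B2Eq228Conditioning.sum_split p]
  simp only [glue_apply_in, glue_apply_out, Pi.zero_apply, zero_mul, sum_const_zero, add_zero,
    mulVec_glue_in, mulVec_zero, Pi.zero_apply, zero_add]
  rfl

/-! ## §2. The two printed exponentials and the bookkeeping (3.15) = (3.23) + (3.25) -/

/-- **The exponential of (3.23)**: `exp[−½⟨A_k, C*Δ^{(k)}CA_k⟩ + ½⟨A_k, C*Δ^{(k)}CC^{(k)}(Λ_{k+1})C*Δ^{(k)}CA_k⟩]`, the weight of the
`A_k|_{Ω_{k+1}∩Λᶜ_{k+1}}`-integration included into `𝐓^{(k+1)}`. [cite: Balaban1988Convergent, (3.23) p.270] -/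
def w323 (y : Out p → ℝ) : ℝ := Real.exp (-(1/2 : ℝ) * pairOut p A y + (1/2 : ℝ) * sandwich p A y)

/-- **The Gaussian factor of the last integral in (3.25)**:
`exp[−½⟨A, C*Δ^{(k)}CA⟩ − ⟨A, C*Δ^{(k)}CA_k⟩ − ½⟨A_k, C*Δ^{(k)}CC^{(k)}(Λ_{k+1})C*Δ^{(k)}CA_k⟩]`. [cite: Balaban1988Convergent, (3.25) p.270] -/
def g325 (x : In p → ℝ) (y : Out p → ℝ) : ℝ :=
  Real.exp (-(1/2 : ℝ) * pairIn p A x - cross p A x y - (1/2 : ℝ) * sandwich p A y)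

/-- `w323 > 0`. [folklore] [cite: Balaban1988Convergent, (3.23) p.270] -/
theorem w323_pos (y : Out p → ℝ) : 0 < w323 p A y := Real.exp_pos _

/-- `g325 > 0`. [folklore] [cite: Balaban1988Convergent, (3.25) p.270] -/
theorem g325_pos (x : In p → ℝ) (y : Out p → ℝ) : 0 < g325 p A x y := Real.exp_pos _

/-- **(3.15) = (3.23) + (3.25) in the exponent.**  For the symmetric operator `C*Δ^{(k)}C` and the fluctuation field
`A_k ⊕ A` on `Ω_{k+1}`: `exp[−½⟨A_k ⊕ A, C*Δ^{(k)}C(A_k ⊕ A)⟩] = exp[−½⟨A_k,·A_k⟩ + ½⟨A_k,·C^{(k)}(Λ_{k+1})·A_k⟩] ·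
exp[−½⟨A,·A⟩ − ⟨A,·A_k⟩ − ½⟨A_k,·C^{(k)}(Λ_{k+1})·A_k⟩]` — the Gaussian of (3.15) is the (3.23) exponential times the (3.25)
Gaussian factor (the `C^{(k)}(Λ_{k+1})`-term is added and subtracted). [cite: Balaban1988Convergent, (3.23)–(3.25) p.270] -/
theorem weight_glue (hA : A.IsSymm) (x : In p → ℝ) (y : Out p → ℝ) :
    weight A (glue p x y) = w323 p A y * g325 p A x y := by
  rw [w323, g325, ← Real.exp_add, weight, quadForm_glue, B2Eq228Conditioning.blkMix'_eq_transpose p hA,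
    dotProduct_transpose_mulVec, pairOut_eq, pairIn_eq, cross_eq]
  congr 1
  ring

/-! ## §3. Why "conditional integral": the (3.25) Gaussian factor is the conditional law of `A` given `A_k` -/

/-- The mean of the conditional law: `−C^{(k)}(Λ_{k+1})(C*Δ^{(k)}CA_k)↾_{Λ_{k+1}} = −M⁻¹Kᵀy` is the tree's conditioning shift
`condShift p A 0 y` of [Balaban1982Higgs2] (2.28) at source `f = 0`. [folklore] [cite: Balaban1988Convergent, (3.25) p.270] -/
theorem condShift_zero_eq (y : Out p → ℝ) :
    condShift p A 0 y = -((blkIn p A)⁻¹ *ᵥ (blkMix p A *ᵥ y)) := by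
  rw [condShift, ← mulVec_neg]
  congr 1
  funext i
  simp [resIn]

/-- The conditioning shift is `−C^{(k)}(Λ_{k+1})` applied to `C*Δ^{(k)}CA_k`, restricted to `Λ_{k+1}`.
[folklore] [cite: Balaban1988Convergent, (3.25) p.270] -/
theorem condShift_zero_eq_CΛ (y : Out p → ℝ) :
    condShift p A 0 y = -resIn p (CΛ p A (A *ᵥ Ak p y)) := by
  rw [condShift_zero_eq, CΛ, resIn_glue, resIn_mulVec_Ak]

/-- **Completing the square**: for symmetric `C*Δ^{(k)}C` with invertible `Λ`-block,
`g325(A, A_k) = exp[−½⟨A − m, M(A − m)⟩]` with `m = −M⁻¹Kᵀy` the conditional mean — the (3.25) Gaussian factor is the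
(un-normalized) density of the Gaussian measure on `Λ_{k+1}` with mean `m(A_k)` and covariance `C^{(k)}(Λ_{k+1}) = M⁻¹`.
[cite: Balaban1988Convergent, (3.25) p.270] -/
theorem g325_eq_gaussWeight (hA : A.IsSymm) (hdet : IsUnit (blkIn p A).det) (x : In p → ℝ) (y : Out p → ℝ) :
    g325 p A x y = gaussWeight (blkIn p A) (x - condShift p A 0 y) := by
  have hMs : (blkIn p A).IsSymm := by
    ext i j
    simp only [blkIn, submatrix_apply, transpose_apply]
    exact hA.apply i.1 j.1
  set j : In p → ℝ := blkMix p A *ᵥ y with hj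
  have htilt := B2Eq228Conditioning.tilt_eq (blkIn p A) hMs hdet j x
  have hs : sandwich p A y = j ⬝ᵥ ((blkIn p A)⁻¹ *ᵥ j) := by rw [sandwich_eq p A hA]
  rw [condShift_zero_eq, sub_neg_eq_add, ← hj, g325, pairIn_eq, cross_eq, ← hj, hs]
  have h1 : -(1/2 : ℝ) * (x ⬝ᵥ blkIn p A *ᵥ x) - x ⬝ᵥ j - (1/2 : ℝ) * (j ⬝ᵥ ((blkIn p A)⁻¹ *ᵥ j))
      = (-(j ⬝ᵥ x) - 1 / 2 * (x ⬝ᵥ (blkIn p A *ᵥ x))) + (-(1/2 : ℝ) * (j ⬝ᵥ ((blkIn p A)⁻¹ *ᵥ j))) := by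
    rw [dotProduct_comm x j]; ring
  rw [h1, Real.exp_add, htilt, mul_assoc, mul_comm (gaussWeight _ _), ← mul_assoc, ← Real.exp_add]
  have h2 : 1 / 2 * (j ⬝ᵥ ((blkIn p A)⁻¹ *ᵥ j)) + -(1/2 : ℝ) * (j ⬝ᵥ ((blkIn p A)⁻¹ *ᵥ j)) = 0 := by ring
  rw [h2, Real.exp_zero, one_mul]

/-- **The conditional integral** (translation invariance of `dA|_{Λ_{k+1}}`): for EVERY integrand `Ψ`,
`∫dA|_Λ g325(A, A_k) Ψ(A) = ∫dA′ e^{−½⟨A′, MA′⟩} Ψ(A′ + m(A_k))` — integration against the (3.25) Gaussian factor is the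
un-normalized expectation in the Gaussian measure of mean `m(A_k)`, covariance `C^{(k)}(Λ_{k+1})`. [cite: Balaban1988Convergent, (3.25) p.270] -/
theorem integral_g325_mul (hA : A.IsSymm) (hdet : IsUnit (blkIn p A).det) (y : Out p → ℝ) (Ψ : (In p → ℝ) → ℝ) :
    ∫ x, g325 p A x y * Ψ x = gaussInt (blkIn p A) (fun z => Ψ (z + condShift p A 0 y)) := by
  simp_rw [g325_eq_gaussWeight p A hA hdet]
  set c := condShift p A 0 y
  have h := integral_add_right_eq_self (μ := (volume : Measure (In p → ℝ)))
    (fun x => gaussWeight (blkIn p A) (x - c) * Ψ x) c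
  simp only [add_sub_cancel_right] at h
  rw [← h]
  simp only [gaussInt, smul_eq_mul]

/-- The same, as the NORMALIZED conditional expectation: `∫dA|_Λ g325(A,A_k)Ψ(A) = Z^{(k)}(Λ_{k+1}) · ∫dμ_{C^{(k)}(Λ_{k+1})}(A′) Ψ(A′ + m(A_k))`
with `dμ_{C^{(k)}(Λ_{k+1})}` the tree's probability measure `gaussProb (blkIn p A)` (`B2Eq228Conditioning.inner` at source `0`).
[cite: Balaban1988Convergent, (3.25) p.270] -/
theorem integral_g325_mul_eq_inner (hA : A.IsSymm) (hdet : IsUnit (blkIn p A).det)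
    (hN : gaussNorm (blkIn p A) ≠ 0) (y : Out p → ℝ) (Ψ : (In p → ℝ) → ℝ) :
    ∫ x, g325 p A x y * Ψ x = gaussNorm (blkIn p A) * B2Eq228Conditioning.inner p A 0 Ψ y := by
  rw [integral_g325_mul p A hA hdet, B2Eq228Conditioning.inner_eq_gaussInt, ← mul_assoc, mul_inv_cancel₀ hN, one_mul]

/-- **Normalization of the conditional integral**: `∫dA|_{Λ_{k+1}} g325(A, A_k) = Z^{(k)}(Λ_{k+1}) = ∫dA e^{−½⟨A, MA⟩}` for EVERY
exterior field `A_k` (the `log Z^{(k)}(Λ_{k+1})`-constant of (1.26)/(3.33)). [cite: Balaban1988Convergent, (3.25) p.270] -/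
theorem integral_g325 (hA : A.IsSymm) (hdet : IsUnit (blkIn p A).det) (y : Out p → ℝ) :
    ∫ x, g325 p A x y = gaussNorm (blkIn p A) := by
  have h := integral_g325_mul p A hA hdet y (fun _ => 1)
  simp only [mul_one] at h
  rw [h, B13GaugeDevices.gaussInt_one_eq_gaussNorm]

/-! ## §4. THE IDENTITY: the fluctuation integral of (3.15) = `𝐓^{(k+1)}` applied to the last integral of (3.25) -/

omit [Fintype S] [DecidableEq S] in
/-- A positive definite (real) operator is symmetric. [folklore] [cite: Balaban1988Convergent, (3.23) p.270] -/
theorem isSymm_of_posDef (hA : A.PosDef) : A.IsSymm := by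
  have h := hA.isHermitian.eq
  rwa [conjTranspose_eq_transpose_of_trivial] at h

omit [Fintype S] [DecidableEq S] [DecidablePred p] in
/-- The `Λ × Λ` block of a positive definite operator is positive definite. [folklore] [cite: Balaban1988Convergent, (3.23) p.270] -/
theorem blkIn_posDef (hA : A.PosDef) : (blkIn p A).PosDef := by
  unfold blkIn
  exact hA.submatrix Subtype.val_injective

/-- … hence has invertible determinant. [folklore] [cite: Balaban1988Convergent, (3.23) p.270] -/
theorem isUnit_det_blkIn (hA : A.PosDef) : IsUnit (blkIn p A).det :=
  isUnit_iff_ne_zero.2 (blkIn_posDef p A hA).det_pos.ne'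

/-- **(3.15) = (3.23)∘(3.25), the conditional integration with respect to `A_k` restricted to `Λ_{k+1}`.**  For the positive
operator `C*Δ^{(k)}C` on the fluctuation fields over `Ω_{k+1}` and every function `F` of the fluctuation field for which
the Gaussian integral of (3.15) converges absolutely:
`∫dA_k|_{Ω_{k+1}} exp[−½⟨A_k, C*Δ^{(k)}CA_k⟩] F(A_k)
   = ∫dA_k|_{Ω_{k+1}∩Λᶜ_{k+1}} exp[−½⟨A_k,C*Δ^{(k)}CA_k⟩ + ½⟨A_k,C*Δ^{(k)}CC^{(k)}(Λ_{k+1})C*Δ^{(k)}CA_k⟩]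
       ∫dA|_{Λ_{k+1}} exp[−½⟨A,C*Δ^{(k)}CA⟩ − ⟨A,C*Δ^{(k)}CA_k⟩ − ½⟨A_k,C*Δ^{(k)}CC^{(k)}(Λ_{k+1})C*Δ^{(k)}CA_k⟩] F(A_k ⊕ A)`
— the outer integration is the one *"included into the operation 𝐓^{(k+1)}"* (3.23), the inner one is the last
fluctuation field integral of (3.25).  Proof: Fubini over `A_k ⊕ A` and §2. [cite: Balaban1988Convergent, (3.23)–(3.25) p.270] -/
theorem integral_weight_mul_eq (hA : A.PosDef) (F : (S → ℝ) → ℝ)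
    (hint : Integrable fun φ : S → ℝ => weight A φ * F φ) :
    ∫ φ, weight A φ * F φ = ∫ y, w323 p A y * ∫ x, g325 p A x y * F (glue p x y) := by
  have hAs : A.IsSymm := isSymm_of_posDef A hA
  set Φ : (In p → ℝ) × (Out p → ℝ) → ℝ := fun q => weight A (glue p q.1 q.2) * F (glue p q.1 q.2) with hΦdef
  have eL : (∫ φ, weight A φ * F φ) = ∫ q, Φ q := B2Eq228Conditioning.integral_eq_integral_glue p _
  have hΦ : Integrable Φ := (B2Eq228Conditioning.integrable_iff_integrable_glue p _).1 hint
  rw [eL]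
  refine (integral_prod_symm Φ hΦ).trans (integral_congr_ae (Filter.Eventually.of_forall fun y => ?_))
  show ∫ x, Φ (x, y) = _
  simp only [hΦdef, weight_glue p A hAs, mul_assoc]
  exact integral_const_mul _ _

/-- The Gaussian weight `exp[−½⟨A_k, C*Δ^{(k)}CA_k⟩]` on `Ω_{k+1}` is integrable. [folklore] [cite: Balaban1988Convergent, (3.23) p.270] -/
theorem integrable_weight (hA : A.PosDef) : Integrable (weight A) := by
  have h := B2Eq228Conditioning.integrable_gaussWeight hA
  refine h.congr (Filter.Eventually.of_forall fun φ => ?_)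
  rw [B2Eq228Conditioning.gaussWeight_eq, weight]

/-- **(3.15) = (3.23)∘(3.25) with all hypotheses discharged** for a bounded measurable function of the fluctuation field
(the printed integrand: characteristic functions times exponentials of the bounded-above interaction).
[cite: Balaban1988Convergent, (3.23)–(3.25) p.270] -/
theorem integral_weight_mul_eq_of_bounded (hA : A.PosDef) {F : (S → ℝ) → ℝ} (hF : Measurable F)
    {C : ℝ} (hb : ∀ φ, |F φ| ≤ C) :
    ∫ φ, weight A φ * F φ = ∫ y, w323 p A y * ∫ x, g325 p A x y * F (glue p x y) := by
  refine integral_weight_mul_eq p A hA F ?_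
  exact (integrable_weight A hA).bdd_mul hF.aestronglyMeasurable
    (Filter.Eventually.of_forall fun φ => by rw [Real.norm_eq_abs]; exact hb φ) |>.congr
    (Filter.Eventually.of_forall fun φ => by ring)

/-- **The `A_k`-part of the one-step operation `𝐓^{(k+1)}` of (3.23)** in the block model: for a finite family `adm` of
admissible sets `S_{k+1}` (index type `σ`), the constant `z^{(k)}` (*"the product of factors corresponding to bonds in
Γ_{k+1}∩Λᶜ_{k+1}"*) and the characteristic functions `χ(Ω_{k+1}∩Λᶜ_{k+1}, S_{k+1})` of `A_k`:
`Φ ↦ Σ_{S∈adm} z^{(k)} ∫dA_k|_{Ω∩Λᶜ} χ(Ω∩Λᶜ,S)(A_k) exp[−½⟨A_k,·A_k⟩ + ½⟨A_k,·C^{(k)}(Λ)·A_k⟩] Φ_S(A_k)`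
(the `V_k`-integration `∫dV_k δ(V̄_kV⁻¹_{k+1})ζ(Ωᶜ_{k+1})` of (3.23) acts on other variables and is not modelled).
[cite: Balaban1988Convergent, (3.23) p.270] -/
def opT323 {σ : Type*} (adm : Finset σ) (zk : ℝ) (χ : σ → (Out p → ℝ) → ℝ) (Φ : σ → (Out p → ℝ) → ℝ) : ℝ :=
  ∑ s ∈ adm, zk * ∫ y, χ s y * w323 p A y * Φ s y

/-- **The last fluctuation field integral of (3.25)** in the block model, as a function of the admissible set `S_{k+1}`
and of `A_k`: `z^{(k)} ∫dA|_{Λ_{k+1}} χ^{(k)}(Λ_{k+1})(A) exp[−½⟨A,·A⟩ − ⟨A,·A_k⟩ − ½⟨A_k,·C^{(k)}(Λ_{k+1})·A_k⟩ + W_S(A_k, A)]`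
with `W_S = 𝐏^{(k)}(g_k,(A_k,A)) + {…} + 𝐕^{(k)}(S_{k+1},(A_k,A))` abstract and `z^{(k)}` the product of factors of the
`Λ_{k+1}`-bonds. [cite: Balaban1988Convergent, (3.25) p.270] -/
def inner325 {σ : Type*} (zΛ : ℝ) (χΛ : (In p → ℝ) → ℝ) (W : σ → (In p → ℝ) → (Out p → ℝ) → ℝ)
    (s : σ) (y : Out p → ℝ) : ℝ :=
  zΛ * ∫ x, g325 p A x y * (χΛ x * Real.exp (W s x y))

/-- **(3.25)** (its Gaussian content, kind «model-instance»): the fluctuation-field integral of (3.15), written as the sum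
over the admissible sets `S_{k+1}` of the terms `z^{(k)}(Γ∩Λᶜ) z^{(k)}(Λ) ∫dA_k|_{Ω_{k+1}} exp[−½⟨A_k,C*Δ^{(k)}CA_k⟩]
χ(Ω∩Λᶜ, S)(A_k|_{Ω∩Λᶜ}) χ^{(k)}(Λ)(A_k|_Λ) exp[W_S]`, EQUALS the one-step operation `𝐓^{(k+1)}` of (3.23) applied to the last
fluctuation field integral of (3.25) — for `C*Δ^{(k)}C` positive definite and every term absolutely convergent.
[cite: Balaban1988Convergent, (3.25) p.270] -/
theorem eq325 {σ : Type*} (hA : A.PosDef) (adm : Finset σ) (zk zΛ : ℝ)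
    (χ : σ → (Out p → ℝ) → ℝ) (χΛ : (In p → ℝ) → ℝ) (W : σ → (In p → ℝ) → (Out p → ℝ) → ℝ)
    (hint : ∀ s ∈ adm, Integrable fun φ : S → ℝ =>
      weight A φ * (χ s (resOut p φ) * (χΛ (resIn p φ) * Real.exp (W s (resIn p φ) (resOut p φ))))) :
    ∑ s ∈ adm, zk * zΛ * ∫ φ, weight A φ *
        (χ s (resOut p φ) * (χΛ (resIn p φ) * Real.exp (W s (resIn p φ) (resOut p φ))))
      = opT323 p A adm zk χ (inner325 p A zΛ χΛ W) := by
  unfold opT323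
  refine Finset.sum_congr rfl fun s hs => ?_
  rw [integral_weight_mul_eq p A hA _ (hint s hs), mul_assoc]
  congr 1
  rw [← integral_const_mul]
  refine integral_congr_ae (Filter.Eventually.of_forall fun y => ?_)
  simp only [inner325, resIn_glue, resOut_glue]
  have h1 : ∫ x, g325 p A x y * (χ s y * (χΛ x * Real.exp (W s x y)))
      = χ s y * ∫ x, g325 p A x y * (χΛ x * Real.exp (W s x y)) := by
    rw [← integral_const_mul]
    refine integral_congr_ae (Filter.Eventually.of_forall fun x => ?_)
    ring
  rw [h1]
  ring

/-! ## §5. The (3.23) exponential is the marginal weight of `A_k`; the Schur complement -/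

/-- **The (3.23) exponential as a marginal**: integrating the Gaussian of (3.15) over `A = A_k|_{Λ_{k+1}}` alone leaves
`Z^{(k)}(Λ_{k+1}) · exp[−½⟨A_k,C*Δ^{(k)}CA_k⟩ + ½⟨A_k,C*Δ^{(k)}CC^{(k)}(Λ_{k+1})C*Δ^{(k)}CA_k⟩]` — the weight of the remaining
`A_k|_{Ω∩Λᶜ}`-integration of `𝐓^{(k+1)}`. [cite: Balaban1988Convergent, (3.23) p.270] -/
theorem integral_weight_glue (hA : A.IsSymm) (hdet : IsUnit (blkIn p A).det) (y : Out p → ℝ) :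
    ∫ x, weight A (glue p x y) = gaussNorm (blkIn p A) * w323 p A y := by
  simp_rw [weight_glue p A hA]
  rw [integral_const_mul, integral_g325 p A hA hdet, mul_comm]

/-- The Schur complement `S = N − K M⁻¹ Kᵀ` of the `Λ`-block of `C*Δ^{(k)}C` (the inverse covariance of the marginal law of
`A_k|_{Ω∩Λᶜ}`). [folklore] [cite: Balaban1988Convergent, (3.23) p.270] -/
def schur : Matrix (Out p) (Out p) ℝ := blkOut p A - blkMix' p A * (blkIn p A)⁻¹ * blkMix p A

/-- **The (3.23) exponential is the Gaussian weight of the Schur complement**: `w323(A_k) = exp[−½⟨A_k, S A_k⟩]`.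
[cite: Balaban1988Convergent, (3.23) p.270] -/
theorem w323_eq_schur (y : Out p → ℝ) : w323 p A y = gaussWeight (schur p A) y := by
  rw [w323, gaussWeight, pairOut_eq, sandwich_eq_matrix, schur, sub_mulVec, dotProduct_sub]
  congr 1
  ring

/-- The quadratic form of `C*Δ^{(k)}C` at `A_k ⊕ A` with `A = m(A_k) + x′`: Schur's decomposition
`⟨φ, Tφ⟩ = ⟨x′, Mx′⟩ + ⟨y, Sy⟩` for `φ = glue (x′ + m(y)) y` (symmetric `T`, invertible `M`). [folklore] [cite: Balaban1988Convergent, (3.23) p.270] -/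
theorem quadForm_glue_shift (hA : A.IsSymm) (hdet : IsUnit (blkIn p A).det) (x' : In p → ℝ) (y : Out p → ℝ) :
    glue p (x' + condShift p A 0 y) y ⬝ᵥ A *ᵥ glue p (x' + condShift p A 0 y) y
      = x' ⬝ᵥ blkIn p A *ᵥ x' + y ⬝ᵥ schur p A *ᵥ y := by
  -- read off from the exponentials: weight = w323 · g325, g325 = gaussWeight M (x' ), w323 = gaussWeight S
  have h := weight_glue p A hA (x' + condShift p A 0 y) y
  rw [g325_eq_gaussWeight p A hA hdet, add_sub_cancel_right, w323_eq_schur, weight, gaussWeight, gaussWeight,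
    ← Real.exp_add] at h
  have h2 := Real.exp_injective h
  linarith

/-- **The Schur complement is positive definite** (so the (3.23) weight is a genuine Gaussian weight on the
`A_k|_{Ω∩Λᶜ}`-variables) — from the positivity of `C*Δ^{(k)}C`. [folklore] [cite: Balaban1988Convergent, (3.23) p.270] -/
theorem schur_posDef (hA : A.PosDef) : (schur p A).PosDef := by
  have hAs : A.IsSymm := isSymm_of_posDef A hA
  have hdet := isUnit_det_blkIn p A hA
  have hMs : (blkIn p A).IsSymm := by
    ext i j
    simp only [blkIn, submatrix_apply, transpose_apply]
    exact hAs.apply i.1 j.1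
  have hSymm : (schur p A).IsSymm := by
    unfold schur
    rw [Matrix.IsSymm, transpose_sub, transpose_mul, transpose_mul, B2Eq228Conditioning.blkMix'_eq_transpose p hAs,
      transpose_transpose, transpose_nonsing_inv, hMs.eq, Matrix.mul_assoc]
    congr 1
    ext i j
    simp only [blkOut, submatrix_apply, transpose_apply]
    exact hAs.apply i.1 j.1
  refine Matrix.PosDef.of_dotProduct_mulVec_pos ?_ fun y hy => ?_
  · rw [Matrix.IsHermitian, conjTranspose_eq_transpose_of_trivial]; exact hSymm.eq
  · have h := quadForm_glue_shift p A hAs hdet 0 y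
    simp only [zero_add, mulVec_zero, dotProduct_zero] at h
    have hne : glue p (condShift p A 0 y) y ≠ 0 := by
      intro h0
      apply hy
      have := congrArg (resOut p) h0
      rw [resOut_glue] at this
      rw [this]; rfl
    have hpos := hA.dotProduct_mulVec_pos hne
    simp only [star_trivial] at hpos
    rw [h] at hpos
    simpa using hpos

/-- **The normalizations multiply**: `∫dA_k|_{Ω_{k+1}} e^{−½⟨A_k,C*Δ^{(k)}CA_k⟩} = Z^{(k)}(Λ_{k+1}) · ∫dA_k|_{Ω∩Λᶜ} w323(A_k)` — the constant
produced by the conditional integration (`log Z^{(k)}(Λ_{k+1})` of (1.26), absorbed into `𝐄` / `E₀^{(k)}`) times the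
normalization of the `𝐓^{(k+1)}`-weight. [cite: Balaban1988Convergent, (3.23)–(3.25) p.270] -/
theorem gaussNorm_eq_mul (hA : A.PosDef) :
    (∫ φ, weight A φ) = gaussNorm (blkIn p A) * gaussNorm (schur p A) := by
  have hAs : A.IsSymm := isSymm_of_posDef A hA
  have hdet := isUnit_det_blkIn p A hA
  have h := integral_weight_mul_eq p A hA (fun _ => 1) (by simpa using integrable_weight A hA)
  simp only [mul_one] at h
  rw [h]
  simp_rw [integral_g325 p A hAs hdet, mul_comm (w323 p A _) _, w323_eq_schur]
  rw [integral_const_mul]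
  rfl

/-! ## §6. Knitting with (1.26): the last integral of (3.25) is `exp[log Z^{(k)}(Λ_{k+1}) + 𝐄^{(k+1)}]` -/

open B14.Eq126CondGaussian (lhs126 Z0 E1 mid126)

/-- The last fluctuation field integral of (3.25) with the interaction written as in (1.26), `W = v − g⁻²V`, is
`e^{−½⟨A_k,…C^{(k)}(Λ_{k+1})…A_k⟩}` times the left member `lhs126` of (1.26) (`B14.Eq126CondGaussian`, blocks `M = blkIn`,
`K = blkMix'`, exterior field `Λᶜ A = A_k`). [cite: Balaban1988Convergent, (3.25) p.270] -/
theorem inner_eq_exp_neg_half_sandwich_mul_lhs126 (hA : A.IsSymm) (χΛ : (In p → ℝ) → ℝ)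
    (v V : (In p → ℝ) → (Out p → ℝ) → ℝ) (g : ℝ) (y : Out p → ℝ) :
    ∫ x, g325 p A x y * (χΛ x * Real.exp (v x y - (1 / g ^ 2) * V x y))
      = Real.exp (-(1/2 : ℝ) * sandwich p A y) * lhs126 (blkIn p A) (blkMix' p A) χΛ v V g y := by
  rw [lhs126, ← integral_const_mul]
  refine integral_congr_ae (Filter.Eventually.of_forall fun x => ?_)
  have hcross : cross p A x y = y ⬝ᵥ blkMix' p A *ᵥ x := by
    rw [cross_eq, B2Eq228Conditioning.blkMix'_eq_transpose p hA, dotProduct_transpose_mulVec]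
  simp only [g325, hcross, pairIn_eq]
  rw [show -(1/2 : ℝ) * (x ⬝ᵥ blkIn p A *ᵥ x) - y ⬝ᵥ blkMix' p A *ᵥ x - (1/2 : ℝ) * sandwich p A y
      = (-(1/2 : ℝ) * sandwich p A y) + (-(1/2 : ℝ) * (x ⬝ᵥ blkIn p A *ᵥ x) - y ⬝ᵥ blkMix' p A *ᵥ x) by ring,
    Real.exp_add, show -(1/2 : ℝ) * (x ⬝ᵥ blkIn p A *ᵥ x) - y ⬝ᵥ blkMix' p A *ᵥ x + (v x y - 1 / g ^ 2 * V x y)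
      = (-(1/2 : ℝ) * (x ⬝ᵥ blkIn p A *ᵥ x) - y ⬝ᵥ blkMix' p A *ᵥ x) + (v x y - 1 / g ^ 2 * V x y) by ring,
    Real.exp_add]
  ring

/-- **The point of the split (3.23)/(3.25)**: by the definition (1.26) of `𝐄` (one level up: `Z^{(k)}(Λ_{k+1})`,
`C^{(k)}(Λ_{k+1})`, `𝐄^{(k+1)}(Λ_{k+1}, g_k, A_k)`), the last fluctuation field integral of (3.25) is EXACTLY
`exp[log Z^{(k)}(Λ_{k+1}) + 𝐄^{(k+1)}(Λ_{k+1}, g_k, A_k)]` — the subtracted term `½⟨A_k, C*Δ^{(k)}CC^{(k)}(Λ_{k+1})C*Δ^{(k)}CA_k⟩`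
cancels the completed square of (1.26), leaving the logarithm in the inductive form (p. 270: *"Now the fundamental problem
is to represent the logarithm of the last fluctuation field integral in the form described by the inductive assumption"*).
Hypotheses: `C*Δ^{(k)}C` positive definite, the normalized integral positive. [cite: Balaban1988Convergent, (3.25) p.270] -/
theorem inner_eq_exp_logZ_add_E (hA : A.PosDef) (χΛ : (In p → ℝ) → ℝ)
    (v V : (In p → ℝ) → (Out p → ℝ) → ℝ) (g : ℝ) (y : Out p → ℝ)
    (hpos : 0 < mid126 (blkIn p A) (blkMix' p A) χΛ v V g y) :
    ∫ x, g325 p A x y * (χΛ x * Real.exp (v x y - (1 / g ^ 2) * V x y))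
      = Real.exp (Real.log (Z0 (blkIn p A)) + E1 (blkIn p A) (blkMix' p A) χΛ v V g y) := by
  have hAs : A.IsSymm := isSymm_of_posDef A hA
  have hM : (blkIn p A).PosDef := blkIn_posDef p A hA
  rw [inner_eq_exp_neg_half_sandwich_mul_lhs126 p A hAs,
    B14.Eq126CondGaussian.eq126 hM (blkMix' p A) χΛ v V g y hpos, ← Real.exp_add]
  congr 1
  have hs : sandwich p A y = y ⬝ᵥ (blkMix' p A * (blkIn p A)⁻¹ * (blkMix' p A)ᵀ) *ᵥ y := by
    rw [sandwich_eq_matrix, B2Eq228Conditioning.blkMix'_eq_transpose p hAs, transpose_transpose]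
  rw [hs]
  ring

omit [DecidableEq S] in
/-- `Z^{(k)}(Λ_{k+1})` of (1.26)/(3.25) is the tree's `gaussNorm` of the `Λ`-block (two spellings of `∫dA e^{−½⟨A,MA⟩}`).
[folklore] [cite: Balaban1988Convergent, (3.25) p.270] -/
theorem Z0_eq_gaussNorm (M : Matrix (In p) (In p) ℝ) : Z0 M = gaussNorm M := by
  rw [Z0, gaussNorm]
  refine integral_congr_ae (Filter.Eventually.of_forall fun x => ?_)
  rw [B2Eq228Conditioning.gaussWeight_eq]

/-! ## §7. (3.24): `𝐓_{k+1} = 𝐓^{(k+1)} 𝐓_k` for the operations defined by (2.20) -/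

/-- **(3.24)** `𝐓_{k+1} = 𝐓^{(k+1)}𝐓_k` for the operations DEFINED by (2.20) from one-step operations (`Step.TkOps.ofOneStep`,
regions `Z_j`, one-step operations `T1 k j` = `𝐓^{(j)}` of (2.20)/(2.21) as they stand after step `k`): the ordered product
(2.20) at `k + 1` is the newest one-step operation (print's `𝐓^{(k+1)}` of (3.23) = the `𝐓^{(k)}` of (2.21), integrating
`V_k, A_k`) times the ordered product of the lower ones (`tail (k+1) k X` = `𝐓_k(X)` with its one-step factors as they stand
after step `k + 1`; cf. (2.22)). [cite: Balaban1988Convergent, (3.24) p.270] -/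
theorem eq324 {ι : Type*} {M : Type*} [Monoid M] (Z : ℕ → Set ι) (T1 : ℕ → ℕ → Set ι → M) (k : ℕ) (X : Set ι) :
    (Step.TkOps.ofOneStep Z T1).T (k + 1) X
      = T1 (k + 1) k (Z (k + 1) ∩ X) * (Step.TkOps.ofOneStep Z T1).tail (k + 1) k X := by
  show (((List.range (k + 1)).reverse).map fun j => T1 (k + 1) j (Z (j + 1) ∩ X)).prod = _
  rw [Step.TkOps.tail, List.range_succ, List.reverse_append, List.reverse_singleton, List.singleton_append,
    List.map_cons, List.prod_cons]
  rfl

/-- (3.24) iterated down to scale `m ≤ k + 1` (the form (2.22) in which the factorization is used):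
`𝐓_{k+1}(X) = 𝐓^{(k+1)}(Z_{k+1}∩X) · Π_{j=k−1}^{m} 𝐓^{(j)}(Z_{j+1}∩X) · 𝐓_m(X)`. [cite: Balaban1988Convergent, (3.24) p.270] -/
theorem eq324_split {ι : Type*} {M : Type*} [Monoid M] (Z : ℕ → Set ι) (T1 : ℕ → ℕ → Set ι → M) (k m : ℕ)
    (hm : m ≤ k) (X : Set ι) :
    (Step.TkOps.ofOneStep Z T1).T (k + 1) X
      = T1 (k + 1) k (Z (k + 1) ∩ X)
        * ((((List.Ico m k).reverse).map fun j => T1 (k + 1) j (Z (j + 1) ∩ X)).prod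
          * (Step.TkOps.ofOneStep Z T1).tail (k + 1) m X) := by
  rw [eq324, Step.TkOps.tail_split _ (k + 1) m k hm X]
  rfl

/-! ## §8. (v1.1) Bridge to the owner's file of record `B14.Eq325Split` (the same displays over the block data) -/

section Bridge

open B14.Eq325Split (blockQF outer323)

omit [DecidableEq S] in
/-- The block quadratic form of `B14.Eq325Split` at the blocks of a symmetric `C*Δ^{(k)}C` IS the quadratic form of the
fluctuation field `A_k ⊕ A` on `Ω_{k+1}`: `blockQF M K N (A, A_k) = ⟨A_k ⊕ A, C*Δ^{(k)}C (A_k ⊕ A)⟩` (`M = blkIn`, `K = blkMix'`,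
`N = blkOut`). [cite: Balaban1988Convergent, (3.23)–(3.25) p.270] -/
theorem blockQF_eq_quadForm_glue (hA : A.IsSymm) (x : In p → ℝ) (y : Out p → ℝ) :
    blockQF (blkIn p A) (blkMix' p A) (blkOut p A) x y = glue p x y ⬝ᵥ A *ᵥ glue p x y := by
  rw [blockQF, quadForm_glue, B2Eq228Conditioning.blkMix'_eq_transpose p hA, dotProduct_transpose_mulVec]
  ring

/-- The (3.23) exponential of this file is `exp` of the (3.23) exponent `outer323` of `B14.Eq325Split` (symmetric
`C*Δ^{(k)}C`). [cite: Balaban1988Convergent, (3.23) p.270] -/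
theorem w323_eq_exp_outer323 (hA : A.IsSymm) (y : Out p → ℝ) :
    w323 p A y = Real.exp (outer323 (blkIn p A) (blkMix' p A) (blkOut p A) y) := by
  rw [w323, outer323, pairOut_eq, sandwich_eq_matrix, B2Eq228Conditioning.blkMix'_eq_transpose p hA,
    transpose_transpose]

/-- The (3.25) Gaussian factor of this file is `exp` of the free (3.25) exponent `inner325` of `B14.Eq325Split`
(symmetric `C*Δ^{(k)}C`). [cite: Balaban1988Convergent, (3.25) p.270] -/
theorem g325_eq_exp_inner325 (hA : A.IsSymm) (x : In p → ℝ) (y : Out p → ℝ) :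
    g325 p A x y = Real.exp (B14.Eq325Split.inner325 (blkIn p A) (blkMix' p A) x y) := by
  have hcross : cross p A x y = y ⬝ᵥ blkMix' p A *ᵥ x := by
    rw [cross_eq, B2Eq228Conditioning.blkMix'_eq_transpose p hA, dotProduct_transpose_mulVec]
  rw [g325, B14.Eq325Split.inner325, pairIn_eq, hcross, sandwich_eq_matrix,
    B2Eq228Conditioning.blkMix'_eq_transpose p hA, transpose_transpose]

/-- **(3.15) = 𝐓^{(k+1)}[(3.25)-integral] in the vocabulary of `B14.Eq325Split`**: for `C*Δ^{(k)}C` positive definite with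
blocks `M, K, N` and every `F` with `e^{−½ blockQF}F` absolutely convergent on `Ω_{k+1}`-configurations,
`∫dA_k e^{−½ blockQF(A, A_k)} F(A_k ⊕ A) = ∫dA_k|_{Ω∩Λᶜ} e^{outer323(A_k)} ∫dA|_Λ e^{inner325(A, A_k)} F(A_k ⊕ A)` — the two files
of the row combined into one statement. [cite: Balaban1988Convergent, (3.23)–(3.25) p.270] -/
theorem integral_exp_neg_half_blockQF_mul_eq (hA : A.PosDef) (F : (S → ℝ) → ℝ)
    (hint : Integrable fun φ : S → ℝ => weight A φ * F φ) :
    ∫ φ, Real.exp (-(1/2 : ℝ) * blockQF (blkIn p A) (blkMix' p A) (blkOut p A) (resIn p φ) (resOut p φ)) * F φ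
      = ∫ y, Real.exp (outer323 (blkIn p A) (blkMix' p A) (blkOut p A) y)
          * ∫ x, Real.exp (B14.Eq325Split.inner325 (blkIn p A) (blkMix' p A) x y) * F (glue p x y) := by
  have hAs : A.IsSymm := isSymm_of_posDef A hA
  have hL : (fun φ : S → ℝ =>
      Real.exp (-(1/2 : ℝ) * blockQF (blkIn p A) (blkMix' p A) (blkOut p A) (resIn p φ) (resOut p φ)) * F φ)
      = fun φ => weight A φ * F φ := by
    funext φ
    rw [blockQF_eq_quadForm_glue p A hAs, B2Eq228Conditioning.glue_resIn_resOut, weight]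
  rw [hL, integral_weight_mul_eq p A hA F hint]
  refine integral_congr_ae (Filter.Eventually.of_forall fun y => ?_)
  simp only [w323_eq_exp_outer323 p A hAs, g325_eq_exp_inner325 p A hAs]

end Bridge

end Literature.MathematicalPhysics.QuantumFieldTheory.Balaban1983to89.B14Eq325CondIntegral
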